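import Literature.IUT.HodgeArakelov.ThetaEnvDataRecordAutSaturatedOfCor28i
import Literature.IUT.HodgeArakelov.EtaleThetaDataOfSettingHcycOfHgal

/-!
# [IUTchII] Prop 3.4 (i) at the GENUINE data — statement of record of node IUTchII:Prop3.4(i) with binder (P3) REDUCED TO ITS
# GALOIS HALF: `hgal := (HGAL) ∧ (HCYC)` replaced by «∀ α ∃ τ, (HGAL)» ([AbsTopIII] Cor 1.10) + the class-R [EtTh] §1 origin
# clauses, the cyclotomic half being PROVED (`EtaleThetaDataOfSetting.hcyc_of_hgal`)

S. Mochizuki, *Inter-universal Teichmüller theory II*, kurims manuscript (Dec. 2020): Prop 3.4 (i) pp. 91–92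
[cite: Mochizuki2012, Prop 3.4 (i) p.91]; Cor 1.11 (b) p. 49.  Claim key DISPUTED (D-0012).  Refereed inputs BY NAME ([EtTh] =
S. Mochizuki, Publ. RIMS **45** (2009)): Cor. 2.18 (i) p. 60 (F-0620), Prop. 2.4 p. 38 (F-0609), Cor. 2.8 (i) p. 42 (F-0640),
§1 pp. 12–13 (origin clauses `IsEtThOrigin`, `hYcl` = G-w4d021-2, `IsTateOrigin` — class R, never asserted); [AbsTopIII] Cor. 1.10
pp. 41–44 ((HGAL): every topological automorphism of `Π^tp_{X̲̲}` lies over `Inn(τ)|_{G_K}` — the ONE remaining FACT-class input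
of binder (P3), GAP G-w5d169-3).  abc-iut cell, layer L6, WAVE-5 seat abc-iut-w5-d169 (gen 5; holder lineage of node
IUTchII:Prop3.4(i)); D-row D-G-w5d169-3 of 2026-08-26T11:4xZ executed: files `EtaleThetaDataOfSettingCommutatorPairingAut`,
`…CyclotomeKummerRelation`, `…KummerCocycleOfTate`, `…HcycOfHgal` + the classical
`Literature.NumberTheory.GaloisRepresentations.PadicAlgCl.kummer_valuation_rigidity`.

PROOF-ONLY (no definition, no `Prop`-valued fact, nothing restated): the node statement along ROUTE 2 (`_saturated_ofCor28i`,
p444361) with `hgal` SUPPLIED by `EtaleThetaDataOfSetting.hgal_of_hgalois` from `hHGAL : ∀ α ∃ τ, aug(α x) = τ aug(x) τ⁻¹`.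
* **`EtaleLevels.prop34i_multiradiallyDefined_saturated_ofCor28i_ofHgalois`** — [IUTchII] Prop 3.4 (i) MULTIRADIALITY OF SPLIT
  THETA MONOIDS AT THE GENUINE FUNCTOR, residual BY NAME exactly: F-0620 · F-0609 · F-0640 (FACTS) · `hq` (R3) · `hO'`
  (`IsEtThOrigin`) · `hYcl` (G-w4d021-2) · `hT` (`IsTateOrigin`) · `hιe`/`hιX`, `hstd`, `hDtau`, `hΔ` (Route-2 standing inputs) ·
  **`hHGAL` = (HGAL) alone** · the standing record/tower inputs.
* **`EtaleLevels.exists_coeff_prop34i_multiradiallyDefined_saturated_ofCor28i_ofHgalois`** — the same with the coefficient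
  datum DISCHARGED.
Nothing here asserts anything of [IUTchII] or [EtTh]; no side taken on [IUTchIII] Cor 3.12; typed ≠ proved for the binders.
-/

noncomputable section

open Topology

namespace Literature.IUT.HodgeArakelov

open Literature.AnabelianGeometry.EtaleTheta Literature.AnabelianGeometry.SemiGraphs
open CohomologySystemOfContH1 EtaleThetaDataOfSetting TemperedThetaMonoids ThetaCovers
open scoped Literature.AnabelianGeometry.EtaleTheta

namespace EtaleLevels

universe u

variable {p : ℕ} [Fact p.Prime] {D : Literature.AnabelianGeometry.EtaleTheta.ThetaSetting p}
  {E : D.EtaleThetaData} {l : ℕ} (C : E.DoubleUnderline l) (hC : D.Compat) (hS : D.Sec2Hyps)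
  (hl : l.Prime) (hp2 : p ≠ 2) (hpl : p ≠ l) (hζ : ∃ ζ : D.K, IsPrimitiveRoot ζ (4 * l))
  (mods : ∀ M : ℕ+, D.CyclotomeMod l M)
  (f : contCocycles D.toTheta D.DeltaTheta C.GtpYdduu) (hf : f ∈ C.rootCocycles hC)
  (hmods : ∀ (M M' : ℕ+) (h : (M : ℕ) ∣ (M' : ℕ)) (x : D.lDeltaTheta l),
    MuN.red p M M' h ((mods M').red x) = (mods M).red x)
  (h15 : Literature.AnabelianGeometry.EtaleTheta.ThetaSetting.Prop15iii E hC) (L : C.CuspLabels)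
  (hZ : ∀ M : ℕ+, Nonempty (ModelCyclotomes.lDeltaQuot (C.rigidData (mods M) hC hS h15 L) ≃*
    Literature.IUT.HodgeTheaters.ZHat))
  (hcharY : EtaleThetaDataOfSetting.PiYddCharacteristic C)
  (hlim : Function.Bijective (rigidLimHom C hC hS hl hp2 hpl hζ mods f hf hmods h15 L hZ))
  [(EtaleThetaDataOfSetting.PiYdd C).Normal]
  (hq : IsQuotientMap D.toTheta) {N : ℕ+} (μ : D.CyclotomeMod l N)
  (R : RigidData.{0} N l) (hR : R = C.rigidData μ hC hS h15 L) (h218i : R.Cor218_i)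
  -- ROUTE 2 inputs (abc-iut-w5-d118 `rootHyp_of_cor28_i`)
  {T : TemperedCoverData.{u} l} (ε : C.OrbitEmbedding T)
  (hιe : IsOpenEmbedding ε.ι) (hιX : ε.ι.range = T.tp T.PiX)
  (hΔ : ∀ γ : D.PiTemp ≃ₜ* D.PiTemp, D.DeltaTemp.map γ.toMulEquiv.toMonoidHom = D.DeltaTemp)
  (h24 : T.Prop24) (hstd : (ThetaOrbitData.ofEmbedding ε hC hS).IsStandard)
  (h28 : (ThetaOrbitData.ofEmbedding ε hC hS).Cor28_i)
  (hDtau : ∀ Γ : T.Gtp ≃ₜ* T.Gtp, (∀ S ∈ T.tower, S.map Γ.toMulEquiv.toMonoidHom = S) →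
    ∀ Dt ∈ (ThetaOrbitData.ofEmbedding ε hC hS).Dtau,
      Dt.map Γ.toMulEquiv.toMonoidHom ∈ (ThetaOrbitData.ofEmbedding ε hC hS).Dtau)
  -- index / constants / origin / (P3)
  (ι₀ : (Pi C) ≃ₜ* (Pi C))
  {Es : Set ℕ+} (τw : D.CyclotomeTower l Es)
  (O : Submonoid (PadicAlgCl p)ˣ)
  (hO : ∀ (σ : GQp p) (u : (PadicAlgCl p)ˣ), u ∈ O → Units.map (σ : PadicAlgCl p →* PadicAlgCl p) u ∈ O)
  (hO' : D.IsEtThOrigin)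
  -- the class-R §1 origin clauses under which (HCYC) ⟸ (HGAL) (`EtaleThetaDataOfSetting.hcyc_of_hgal`)
  (hYcl : (D.DtpY.map D.toHat.toMonoidHom).topologicalClosure ≤
    D.DtpY.map D.toHat.toMonoidHom ⊔ (⁅⁅D.DeltaHat, D.DeltaHat⁆, D.DeltaHat⁆).topologicalClosure)
  (hT : D.IsTateOrigin)
  -- (P3) = (HGAL) ALONE: every topological automorphism of `Π^tp_{X̲̲}` lies over `Inn(τ)|_{G_K}` ([AbsTopIII] Cor 1.10)
  (hHGAL : ∀ α : (Pi C) ≃ₜ* (Pi C), ∃ τ : GQp p, ∀ x : Pi C, aug C (α x) = τ * aug C x * τ⁻¹)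

/-- **[IUTchII] Prop 3.4 (i) — MULTIRADIALITY OF SPLIT THETA MONOIDS AT THE GENUINE FUNCTOR, (P3) = (HGAL) alone**:
(P1) := {F-0620, `hq`}; (P2) none (saturated index set); (P3) := `hHGAL` ([AbsTopIII] Cor 1.10) + class-R clauses `hYcl`,
`hT` — the cyclotomic half (HCYC) PROVED (`hcyc_of_hgal`); (P4) := `hroot` along ROUTE 2 (F-0609, F-0640, `hΔ`, `ε`).
[cite: Mochizuki2012, Prop 3.4 (i) p.92] -/
theorem prop34i_multiradiallyDefined_saturated_ofCor28i_ofHgalois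
    (c : CyclotomeCoefficients (phi C) (D.lDeltaTheta l) (PadicAlgCl p)ˣ)
    (hlev : ∀ (ζ : cyclotome (PadicAlgCl p)ˣ) (M : ℕ+),
      (((τw.modAll M).red (c.hom ζ) : MuN p M) : (PadicAlgCl p)ˣ) = (ζ : ℕ+ → (PadicAlgCl p)ˣ) M)
    {η : (C.thetaEnvData μ hC hS).PiYdd → MuN p N} (hη : η ∈ (C.thetaEnvData μ hC hS).thetaCocycles)
    (Γ : Type) [Group Γ] :
    haveI := hC.GtpYdd_normal
    ((ex18iii (ThetaSetting.ofDoubleUnderline C μ hC hS hl hp2 hpl hζ hη) Γ).toDagger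
      (TemperedThetaMonoids.prop34iRadialFunctor
        (thetaEnvTransportS C hC hS hl hp2 hpl hζ mods f hf hmods h15 L hZ hcharY hlim hq μ R hR h218i
          (h1LimKummerOn (phi C) (D.lDeltaTheta l) (PiYdd C) c (isOpen_stabilizer_units C)
            (finiteIndex_stabilizer_units C) O) ι₀
          (map_mrange_h1LimKummerOn_eq_of_galois C hq μ τw c hlev O hO hC hS h15 L R hR h218i hO'
            (hgal_of_hgalois C hO' hYcl hT hS hq μ hC h15 L R hR h218i τw hHGAL))
          (image_toLim_theta_thetaEnvData_of_rootHyp C hC hS hl hp2 hpl hζ mods f hf hmods h15 L hZ hcharY hlim hq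
            μ R hR h218i
            (rootHyp_of_cor28_i C ε hq μ hC hS h15 L R hR h218i hιe hιX hΔ h24 hstd h28 hDtau))
          (image_thetaInfty_thetaEnvData_of_rootHyp C hC hS hl hp2 hpl hζ mods f hf hmods h15 L hZ hcharY hlim hq μ
            R hR h218i
            (rootHyp_of_cor28_i C ε hq μ hC hS h15 L R hR h218i hιe hιX hΔ h24 hstd h28 hDtau)) hη)
        Γ)).IsMultiradiallyDefined := by
  haveI := hC.GtpYdd_normal
  exact prop34i_multiradiallyDefined_saturated_ofCor28i C hC hS hl hp2 hpl hζ mods f hf hmods h15 L hZ hcharY hlim hq μ R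
    hR h218i ε hιe hιX hΔ h24 hstd h28 hDtau ι₀ τw O hO hO' (hgal_of_hgalois C hO' hYcl hT hS hq μ hC h15 L R hR h218i τw hHGAL) c hlev hη Γ

/-- **The same with the coefficient datum DISCHARGED**: residual BY NAME {F-0620, F-0609, F-0640, `hq`, `hO'`, `hYcl`, `hT`,
`hΔc`, `hιe`/`hιX`, `hstd`, `hDtau`, `hΔ`, `hHGAL`} plus the standing record/tower inputs. [cite: Mochizuki2012, Prop 3.4 (i) p.92] -/
theorem exists_coeff_prop34i_multiradiallyDefined_saturated_ofCor28i_ofHgalois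
    (hΔc : IsCompact (D.DeltaTheta : Set D.GtpTheta))
    {η : (C.thetaEnvData μ hC hS).PiYdd → MuN p N} (hη : η ∈ (C.thetaEnvData μ hC hS).thetaCocycles)
    (Γ : Type) [Group Γ] :
    haveI := hC.GtpYdd_normal
    ∃ (c : CyclotomeCoefficients (phi C) (D.lDeltaTheta l) (PadicAlgCl p)ˣ)
      (hlev : ∀ (ζ : cyclotome (PadicAlgCl p)ˣ) (M : ℕ+),
        (((τw.modAll M).red (c.hom ζ) : MuN p M) : (PadicAlgCl p)ˣ) = (ζ : ℕ+ → (PadicAlgCl p)ˣ) M),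
      Function.Bijective c.hom ∧
      ((ex18iii (ThetaSetting.ofDoubleUnderline C μ hC hS hl hp2 hpl hζ hη) Γ).toDagger
        (TemperedThetaMonoids.prop34iRadialFunctor
          (thetaEnvTransportS C hC hS hl hp2 hpl hζ mods f hf hmods h15 L hZ hcharY hlim hq μ R hR h218i
            (h1LimKummerOn (phi C) (D.lDeltaTheta l) (PiYdd C) c (isOpen_stabilizer_units C)
              (finiteIndex_stabilizer_units C) O) ι₀
            (map_mrange_h1LimKummerOn_eq_of_galois C hq μ τw c hlev O hO hC hS h15 L R hR h218i hO'
            (hgal_of_hgalois C hO' hYcl hT hS hq μ hC h15 L R hR h218i τw hHGAL))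
            (image_toLim_theta_thetaEnvData_of_rootHyp C hC hS hl hp2 hpl hζ mods f hf hmods h15 L hZ hcharY hlim hq
              μ R hR h218i
              (rootHyp_of_cor28_i C ε hq μ hC hS h15 L R hR h218i hιe hιX hΔ h24 hstd h28 hDtau))
            (image_thetaInfty_thetaEnvData_of_rootHyp C hC hS hl hp2 hpl hζ mods f hf hmods h15 L hZ hcharY hlim hq
              μ R hR h218i
              (rootHyp_of_cor28_i C ε hq μ hC hS h15 L R hR h218i hιe hιX hΔ h24 hstd h28 hDtau)) hη)
          Γ)).IsMultiradiallyDefined := by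
  haveI := hC.GtpYdd_normal
  exact exists_coeff_prop34i_multiradiallyDefined_saturated_ofCor28i C hC hS hl hp2 hpl hζ mods f hf hmods h15 L hZ hcharY
    hlim hq μ R hR h218i ε hιe hιX hΔ h24 hstd h28 hDtau ι₀ τw O hO hO' (hgal_of_hgalois C hO' hYcl hT hS hq μ hC h15 L R hR h218i τw hHGAL) hΔc hη Γ

end EtaleLevels

end Literature.IUT.HodgeArakelov

end
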